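import Mathlib
import HarnessLib
import Literature.Analysis.FluidPDE.TypeIAncientMild
import Literature.Analysis.FluidPDE.MildSolution
import Literature.Analysis.FluidPDE.NSLocalLerayBackwardUniqueness
import Summits.NavierStokesRegularity.NavierStokesRegularity.Theorems.LocalSineTubeDoorProfileAlignedWindowRigidity

/-!
# Route `PoloidalWindowDoor` (staged, nsreg-p1), crux `PoloidalWindowRigidity` — stub `stub_windowToEverywhere`
# of the five-stub birth skeleton (`route-poloidal/bc/PoloidalWindowRigidity_birth.lean`), and the class bridge

Cell ns-regularity-ideate, seat p6 (route-directed support; land `--supports <PoloidalWindowRigidity item>` once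
the route is born — the statement below is VERBATIM the registered stub signature, in tree vocabulary only).

* `isTypeIAncientMild_of_class` — the route's Type-I profile class (rate, continuity on the open slab,
  unit-viscosity Oseen-mild identity between negative times, divergence-free slices) lies in the tree's
  `IsTypeIAncientMild` (joint smoothness from joint real-analyticity,
  `Theorems.LocalSineTubeDoorProfileAlignedWindowRigidityAncient.analyticOnNhd_uncurry`; `heatFlow = heatExtension`
  for positive times) — port of the cell's `IsTypeIProfile.isTypeIAncientMild` (Sketch8A);
* `inner_eq_zero_spread` — identity-theorem spreading for `y ↦ ⟪F y, e⟫`, `F` real-analytic;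
* `stub_windowToEverywhere` — the vorticity slices of a profile of the class are continuous, and if for
  every `s < 0` the component `⟪curl v(s), e⟫` vanishes on some nonempty open set, it vanishes everywhere
  (slice analyticity + identity theorem; = cell `poloidalWindowRigidity_iff`, first half).

WHAT THIS IS NOT: not a claim about Navier–Stokes regularity; a support lemma for a STAGED door route.
-/

noncomputable section

-- the summit and its single sub-problem share the name (CONVENTIONS §1), as in every Theorems file
set_option linter.dupNamespace false

namespace Summit.NavierStokesRegularity.NavierStokesRegularity.Theorems.PoloidalWindowDoorPoloidalWindowRigidityWindow

open MeasureTheory Set Function Filter Topology TopologicalSpace Metric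
open scoped RealInnerProductSpace InnerProductSpace
open Literature.Analysis Literature.Analysis.FluidPDE
open Summit.NavierStokesRegularity.NavierStokesRegularity.Theorems.LocalSineTubeDoorProfileAlignedWindowRigidityAncient
open Summit.NavierStokesRegularity.NavierStokesRegularity.Theorems.LocalSineTubeDoorProfileAlignedWindowRigidity

/-- **The route's profile class lies in the tree's Type-I ancient mild class** `IsTypeIAncientMild C v`
(joint smoothness from joint real-analyticity of Oseen-ancient fields; `heatFlow = heatExtension` for positive
times). -/
theorem isTypeIAncientMild_of_class {C : ℝ} {v : ℝ → EuclideanSpace ℝ (Fin 3) → EuclideanSpace ℝ (Fin 3)}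
    (hrate : HasTypeITimeDecay C v) (hcont : ContinuousOn (uncurry v) (Iio (0 : ℝ) ×ˢ univ))
    (hmild : ∀ s t : ℝ, s < t → t < 0 → ∀ x,
      v t x = UnboundedOperators.heatExtension (v s) (t - s) x - oseenDuhamel 1 s v v t x)
    (hdiv : ∀ t < 0, VectorCalculus.IsDivFree (v t)) : IsTypeIAncientMild C v := by
  refine ⟨(analyticOnNhd_uncurry hcont (bdd_of_hasTypeITimeDecay hrate) hmild).contDiffOn_of_completeSpace,
    fun t ht => hdiv t ht, fun s t hst ht x => ?_, hrate⟩
  rw [heatFlow_of_pos _ (sub_pos.2 hst)]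
  exact hmild s t hst ht x


/-- Identity-theorem spreading for `y ↦ ⟪F(y), e⟫`. -/
theorem inner_eq_zero_spread {F : (EuclideanSpace ℝ (Fin 3)) → (EuclideanSpace ℝ (Fin 3))} (hF : AnalyticOnNhd ℝ F univ) (e : (EuclideanSpace ℝ (Fin 3)))
    {U : Set (EuclideanSpace ℝ (Fin 3))} (hU : IsOpen U) (hne : U.Nonempty) (h : ∀ y ∈ U, ⟪F y, e⟫_ℝ = 0) :
    ∀ y, ⟪F y, e⟫_ℝ = 0 := by
  have hG : AnalyticOnNhd ℝ (fun y => ⟪F y, e⟫_ℝ) univ := by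
    have h1 := (innerSL ℝ e).comp_analyticOnNhd hF
    have h2 : (fun y => ⟪F y, e⟫_ℝ) = (innerSL ℝ e) ∘ F := by
      funext y
      simp only [Function.comp_apply, innerSL_apply_apply]
      exact real_inner_comm _ _
    rw [h2]
    exact h1
  obtain ⟨y₀, hy₀⟩ := hne
  have hev : (fun y => ⟪F y, e⟫_ℝ) =ᶠ[𝓝 y₀] 0 :=
    Filter.eventually_of_mem (hU.mem_nhds hy₀) fun y hy => h y hy
  intro y
  have := hG.eqOn_zero_of_preconnected_of_eventuallyEq_zero isPreconnected_univ (mem_univ y₀) hev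
    (mem_univ y)
  simpa using this

/-- **Stub `stub_windowToEverywhere` of the PoloidalWindowRigidity birth skeleton** (VERBATIM signature): for a
profile of the route's class the vorticity slices `curl v(s)`, `s < 0`, are continuous, and if for some
`e ≠ 0` every slice has a nonempty open set on which `⟪curl v(s), e⟫ = 0`, then `⟪curl v(s), e⟫ ≡ 0` on every
slice (slice analyticity + identity theorem). -/
theorem stub_windowToEverywhere :
    ∀ (C : ℝ) (v : ℝ → EuclideanSpace ℝ (Fin 3) → EuclideanSpace ℝ (Fin 3)),
    Literature.Analysis.FluidPDE.HasTypeITimeDecay C v →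
    ContinuousOn (Function.uncurry v) (Set.Iio (0 : ℝ) ×ˢ Set.univ) →
    (∀ s t : ℝ, s < t → t < 0 → ∀ x, v t x =
      Literature.Analysis.UnboundedOperators.heatExtension (v s) (t - s) x -
        Literature.Analysis.FluidPDE.oseenDuhamel 1 s v v t x) →
    (∀ t < 0, Literature.Analysis.FluidPDE.VectorCalculus.IsDivFree (v t)) →
    (∀ s < 0, Continuous (Literature.Analysis.FluidPDE.curl (v s))) ∧
    ∀ (e : EuclideanSpace ℝ (Fin 3)), e ≠ 0 →
      (∀ s < 0, ∃ U : Set (EuclideanSpace ℝ (Fin 3)), IsOpen U ∧ U.Nonempty ∧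
        ∀ y ∈ U, ⟪Literature.Analysis.FluidPDE.curl (v s) y, e⟫_ℝ = 0) →
      ∀ s < 0, ∀ y, ⟪Literature.Analysis.FluidPDE.curl (v s) y, e⟫_ℝ = 0 := by
  intro C v hrate hcont hmild _
  refine ⟨fun s hs => continuous_curl_slice hrate hcont hmild hs, fun e _ hwin s hs => ?_⟩
  obtain ⟨U, hU, hne, hal⟩ := hwin s hs
  exact inner_eq_zero_spread
    (analyticOnNhd_curl (analyticOnNhd_slice hcont (bdd_of_hasTypeITimeDecay hrate) hmild hs)) e hU hne hal

end Summit.NavierStokesRegularity.NavierStokesRegularity.Theorems.PoloidalWindowDoorPoloidalWindowRigidityWindow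

end
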